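import Summits.ValiantsHypothesis.ValiantsHypothesis.Theorems.LacunarySymmetroidMatrixDescartesCensusDoorA34SheetWindowGramSign

/-!
# `MatrixDescartes` census — DOOR A at `(3,4)`: ★ THE 2 × 2 ORIENTATION LAW (window supports) — a real symmetric three-letter `2 × 2` pencil whose determinant
# has five positive roots is INDEFINITE at `0⁺` and DEFINITE beyond its largest root

HONEST FRAMING.  Object-search cell `pub-symmetroid`, engine seat `val-sym-eng-2` (g10); helper row beside the registered strata line
`Cruxes/DoorA34/Lines/strata.lean` on stmt-ValiantsHypothesis-19980 (`DoorA34 = PosRootLawAt 3 4 18`: OPEN, typed, never asserted here).  This file ASSEMBLES the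
seat's kernel route (…SheetWindowGram: realisability square, degenerate Gram ⇒ ≤ 4 roots; …SheetWindowGramPeeling: generalized Vandermonde non-vanishing and
positivity in every size, ray-sign, padded five-nomial; …SheetWindowGramSign: the peeling steps `E₄ < 0` and `det Q > 0`) into the law that the seat first
LOCATED (22 993/22 993 exact configurations, report HOME/DOOR-A34-ENG2G10-REPORT.md §6(c)) and that explains «lose two to gain one» on the `(3,4)` sheet
(§6(d)–(g): two-scale / semidefinite window ceiling `17` = `stub_nullTopCeiling`'s value, three-scale flag door ceiling `18` = `DoorA34`'s value, in those regimes):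

* `det_pencil_three_letters_eq` — `det(S₀ + x^{d₁}S₁ + x^{d₂}S₂)` as the explicit six-nomial in `det Sᵢ` and `2·polar(Sᵢ,Sⱼ)`;
* `det_pencil_pos_beyond_roots` — under the same hypotheses the determinant is POSITIVE (the pencil DEFINITE) at every `x` beyond all its real roots;
* **`orientation_law`** (and `orientation_law_pencil`, the same in the census notation `Σₗ X^{dₗ}·Sₗ`, `d = (0,d₁,d₂)`) — `S₀, S₁, S₂` real symmetric `2 × 2`, `0 < d₁`, `2d₁ < d₂`, at least FIVE distinct positive roots of `det(S₀ + x^{d₁}S₁ + x^{d₂}S₂)` ⇒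
  `det S₀ < 0 ∧ det S₁ < 0 ∧ 0 < det S₂`.  Proof: five of the roots give a `5 × 6` node matrix annihilating both the coefficient vector `q` of the determinant and
  the cofactor vector `κ` (Laplace, `genVandermonde_det_eq_eval`); a `5 × 5` generalized Vandermonde is non-zero, so `q = λκ`; the polar Gram determinant is
  `(det M)²/4 ≥ 0` (`polarGram_det_nonneg`) and equals `λ³·det Q(κ)` with `det Q(κ) > 0` (`peel_gramDet_pos`), so `λ > 0` (`λ ≠ 0` since the determinant is not
  the zero polynomial); the signs of `det S₀ = q₀`, `det S₁ = q₂`, `det S₂ = q₅` are those of `κ₀ = −D₀`, `κ₂ = −D₂`, `κ₅ = +D₅` (`genVandermonde_det_pos`).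

CONSEQUENCE (prose, not a theorem here): in the window anatomy of a null-top `(3,4)` pencil whose top letter is two-scale or semidefinite, a middle block with five
window roots is the determinant of such a pencil (resp. has Gram inertia `n₊ ≤ 1`), hence the 2 × 2 compression is DEFINITE beyond those roots and the top block
`kᵀFk` — a diagonal entry of it — cannot vanish there: anatomy `≤ 9+1+5+1+0 = 16`, while `(9,4,2) + 2` junctions `= 17`.  Nothing here bounds the sheet in the
kernel; `DoorA34` and the three stubs stay OPEN; registers unchanged (`ζ_sym(3,4) ∈ {18,19}`); nothing on `MatrixDescartes` (stmt-ValiantsHypothesis-18050),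
on `DoorA26` (whose `polar` vocabulary is reused) or on `VP ≠ VNP` — VP≠VNP not moved.  [folklore] linear algebra of interpolation; Descartes' rule.
-/

-- `Summit.ValiantsHypothesis.ValiantsHypothesis.…` repeats a component by the D-0017 layout
-- (single-conjunct summit), which the `dupNamespace` linter flags; the name is mandated.
set_option linter.dupNamespace false

namespace Summit.ValiantsHypothesis.ValiantsHypothesis.Theorems.LacunarySymmetroidMatrixDescartes.Census

open Summit.ValiantsHypothesis.ValiantsHypothesis.Theorems.LacunarySymmetroidMatrixDescartes.WallBubbling.Bubbling (polar polar_apply polar_comm polar_self)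
open Summit.ValiantsHypothesis.ValiantsHypothesis.Theorems.SymmetroidDescartes (eval_det_pencil)
open scoped BigOperators Matrix
open Polynomial Finset

/-- The determinant of a three-letter `2 × 2` pencil on `(0, d₁, d₂)` as an explicit six-nomial in the polar Gram data. [folklore] -/
theorem det_pencil_three_letters_eq (d₁ d₂ : ℕ) (S : Fin 3 → Matrix (Fin 2) (Fin 2) ℝ) :
    ((S 0).map C + (X : ℝ[X]) ^ d₁ • (S 1).map C + (X : ℝ[X]) ^ d₂ • (S 2).map C).det
      = C ((S 0).det) * X ^ 0 + C (2 * polar (S 0) (S 1)) * X ^ d₁ + C ((S 1).det) * X ^ (2 * d₁) + C (2 * polar (S 0) (S 2)) * X ^ d₂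
        + C (2 * polar (S 1) (S 2)) * X ^ (d₁ + d₂) + C ((S 2).det) * X ^ (2 * d₂) := by
  have hp : ∀ A B : Matrix (Fin 2) (Fin 2) ℝ, 2 * polar A B = A 0 0 * B 1 1 + B 0 0 * A 1 1 - A 0 1 * B 1 0 - B 0 1 * A 1 0 :=
    fun A B => by rw [polar_apply]; ring
  rw [hp, hp, hp]
  simp only [Matrix.det_fin_two, Matrix.add_apply, Matrix.smul_apply, Matrix.map_apply, smul_eq_mul, map_add, map_sub, map_mul]
  ring

/-- **★ THE ORIENTATION LAW (2 × 2, window supports).**  Let `S₀, S₁, S₂` be real symmetric `2 × 2` letters and `0 < d₁`, `2d₁ < d₂`.  If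
`det(S₀ + x^{d₁}S₁ + x^{d₂}S₂)` has at least FIVE distinct positive roots, then `det S₀ < 0`, `det S₁ < 0` and `det S₂ > 0`: the pencil is INDEFINITE at `0⁺`
and DEFINITE beyond its largest root.  (The coefficient vector of the determinant is annihilated by the `5 × 6` node matrix of five of the roots, whose kernel is the
line of the cofactor vector — a `5 × 5` generalized Vandermonde is non-zero —, so the determinant is `λ ×` the interpolant; realisability
`polarGram_det_eq_sq_div_four` and `peel_gramDet_pos` force `λ > 0`; the signs are then those of the cofactors, fixed by `genVandermonde_det_pos`.)  This is the
law behind «lose two to gain one» on the `(3,4)` sheet (report HOME/DOOR-A34-ENG2G10-REPORT.md §6). [folklore] -/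
theorem orientation_law (d₁ d₂ : ℕ) (hd₁ : 0 < d₁) (hw : 2 * d₁ < d₂) (S : Fin 3 → Matrix (Fin 2) (Fin 2) ℝ) (hS : ∀ l, (S l).IsSymm)
    (h5 : 5 ≤ ((((S 0).map C + (X : ℝ[X]) ^ d₁ • (S 1).map C + (X : ℝ[X]) ^ d₂ • (S 2).map C).det).roots.toFinset.filter (fun t => 0 < t)).card) :
    (S 0).det < 0 ∧ (S 1).det < 0 ∧ 0 < (S 2).det := by
  classical
  -- the six-nomial and its coefficient vector
  set E : Fin 6 → ℕ := ![0, d₁, 2 * d₁, d₂, d₁ + d₂, 2 * d₂] with hE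
  have hEmono : StrictMono E := by
    refine Fin.strictMono_iff_lt_succ.2 fun i => ?_
    fin_cases i <;> simp [hE] <;> omega
  set q : Fin 6 → ℝ := ![(S 0).det, 2 * polar (S 0) (S 1), (S 1).det, 2 * polar (S 0) (S 2), 2 * polar (S 1) (S 2), (S 2).det] with hq
  set f : ℝ[X] := ((S 0).map C + (X : ℝ[X]) ^ d₁ • (S 1).map C + (X : ℝ[X]) ^ d₂ • (S 2).map C).det with hf
  have hfsum : f = ∑ j : Fin 6, C (q j) * X ^ E j := by
    rw [hf, det_pencil_three_letters_eq, Fin.sum_univ_six]; simp [hq, hE]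
  have hfne : f ≠ 0 := by
    intro h0; rw [h0, roots_zero, Multiset.toFinset_zero, Finset.filter_empty, Finset.card_empty] at h5; omega
  -- five distinct positive roots, in increasing order
  obtain ⟨T, hTs, hTcard⟩ := Finset.exists_subset_card_eq h5
  set r : Fin 5 → ℝ := fun i => T.orderEmbOfFin hTcard i with hr
  have hrmono : StrictMono r := fun i j hij => (T.orderEmbOfFin hTcard).strictMono hij
  have hrmem : ∀ i, 0 < r i ∧ f.eval (r i) = 0 := by
    intro i
    have hm := hTs (T.orderEmbOfFin_mem hTcard i)
    rw [Finset.mem_filter, Multiset.mem_toFinset, mem_roots hfne, IsRoot.def] at hm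
    exact ⟨hm.2, hm.1⟩
  have hr0 : 0 < r 0 := (hrmem 0).1
  -- the cofactor vector κ and the minors D
  set D : Fin 6 → ℝ := fun j => (Matrix.of fun (i : Fin 5) (l : Fin 5) => r i ^ E (j.succAbove l)).det with hD
  set κ : Fin 6 → ℝ := fun j => (-1) ^ ((4 + 1) + (j : ℕ)) * D j with hκ
  have hDpos : ∀ j, 0 < D j := fun j =>
    genVandermonde_det_pos 4 r (fun l => E (j.succAbove l)) hrmono hr0 (hEmono.comp (Fin.strictMono_succAbove j))
  -- both q and κ are annihilated by the node matrix
  have hWq : ∀ i, ∑ j, r i ^ E j * q j = 0 := by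
    intro i
    have := (hrmem i).2
    rw [hfsum, eval_finsetSum] at this
    simp only [eval_mul, eval_C, eval_pow, eval_X] at this
    rw [← this]; exact Finset.sum_congr rfl fun j _ => mul_comm _ _
  have hWκ : ∀ i, ∑ j, r i ^ E j * κ j = 0 := by
    intro i
    have h := genVandermonde_det_eq_eval r E (r i)
    have hzero : (Matrix.of fun (i' : Fin 6) (j : Fin 6) => (Fin.snoc r (r i) : Fin 6 → ℝ) i' ^ E j).det = 0 := by
      refine Matrix.det_zero_of_row_eq (i := Fin.castSucc i) (j := Fin.last 5) (Fin.castSucc_lt_last i).ne ?_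
      ext j; simp only [Matrix.of_apply, Fin.snoc_castSucc, Fin.snoc_last]
    rw [hzero, eval_finsetSum] at h
    simp only [eval_mul, eval_C, eval_pow, eval_X] at h
    rw [h]; exact Finset.sum_congr rfl fun j _ => by simp only [hκ, hD]; ring
  -- q = λ • κ
  set lam : ℝ := q (Fin.last 5) / κ (Fin.last 5) with hlam
  have hκ5 : κ (Fin.last 5) = D (Fin.last 5) := by
    rw [hκ]; simp only [Fin.val_last]
    rw [show (4 + 1 + 5 : ℕ) = 2 * 5 by norm_num, pow_mul, neg_one_sq, one_pow, one_mul]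
  have hκ5ne : κ (Fin.last 5) ≠ 0 := by rw [hκ5]; exact (hDpos _).ne'
  have hv5 : q (Fin.last 5) - lam * κ (Fin.last 5) = 0 := by rw [hlam]; field_simp; ring
  have hv : ∀ j, q j - lam * κ j = 0 := by
    set v : Fin 5 → ℝ := fun l => q (Fin.castSucc l) - lam * κ (Fin.castSucc l) with hvdef
    have hW' : (Matrix.of fun (i : Fin 5) (l : Fin 5) => r i ^ E (Fin.castSucc l)) *ᵥ v = 0 := by
      ext i
      simp only [Matrix.mulVec, dotProduct, Matrix.of_apply, Pi.zero_apply, hvdef]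
      have h1 := hWq i; have h2 := hWκ i
      rw [Fin.sum_univ_castSucc] at h1 h2
      have hsplit : ∑ x : Fin 5, r i ^ E (Fin.castSucc x) * (q (Fin.castSucc x) - lam * κ (Fin.castSucc x))
          = (∑ x : Fin 5, r i ^ E (Fin.castSucc x) * q (Fin.castSucc x)) - lam * ∑ x : Fin 5, r i ^ E (Fin.castSucc x) * κ (Fin.castSucc x) := by
        rw [Finset.mul_sum, ← Finset.sum_sub_distrib]; exact Finset.sum_congr rfl fun x _ => by ring
      rw [hsplit]
      linear_combination h1 - lam * h2 - (r i ^ E (Fin.last 5)) * hv5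
    have hdet : (Matrix.of fun (i : Fin 5) (l : Fin 5) => r i ^ E (Fin.castSucc l)).det ≠ 0 :=
      genVandermonde_det_ne_zero r (fun l => E (Fin.castSucc l)) hrmono.injective (fun i => (hrmem i).1)
        (hEmono.comp Fin.strictMono_castSucc).injective
    have hv0 : v = 0 := Matrix.eq_zero_of_mulVec_eq_zero hdet hW'
    intro j
    induction j using Fin.lastCases with
    | last => exact hv5
    | cast l => have := congrFun hv0 l; simpa [hvdef] using this
  have hqκ : ∀ j, q j = lam * κ j := fun j => by linarith [hv j]
  -- Gram determinants: det Q(q) = (det M)²/4 ≥ 0 and det Q(q) = lam³ · det Q(κ) with det Q(κ) > 0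
  have hgram_q : 0 ≤ (Matrix.of fun i j : Fin 3 => polar (S i) (S j)).det := polarGram_det_nonneg S hS
  have hQq : (Matrix.of fun i j : Fin 3 => polar (S i) (S j)).det
      = q 0 * q 2 * q 5 + q 1 * q 3 * q 4 / 4 - q 0 * q 4 ^ 2 / 4 - q 2 * q 3 ^ 2 / 4 - q 5 * q 1 ^ 2 / 4 := by
    simp only [Matrix.det_fin_three, Matrix.of_apply, hq, Matrix.cons_val_zero, Matrix.cons_val_one, Matrix.head_cons, Matrix.cons_val_two,
      Matrix.tail_cons]
    rw [polar_self, polar_self, polar_self, polar_comm (S 1) (S 0), polar_comm (S 2) (S 0), polar_comm (S 2) (S 1)]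
    simp only [Fin.isValue, Matrix.cons_val]
    ring
  have hrvec : (![r 0, r 1, r 2, r 3, r 4] : Fin 5 → ℝ) = r := by ext i; fin_cases i <;> rfl
  have hD' : ∀ j : Fin 6, D j = (Matrix.of fun (i : Fin 5) (l : Fin 5) =>
      (![r 0, r 1, r 2, r 3, r 4] : Fin 5 → ℝ) i ^ (![0, d₁, 2 * d₁, d₂, d₁ + d₂, 2 * d₂] : Fin 6 → ℕ) (j.succAbove l)).det := by
    intro j; rw [hrvec]
  have h01 : r 0 < r 1 := hrmono (show (0 : Fin 5) < 1 by decide)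
  have h12 : r 1 < r 2 := hrmono (show (1 : Fin 5) < 2 by decide)
  have h23 : r 2 < r 3 := hrmono (show (2 : Fin 5) < 3 by decide)
  have h34 : r 3 < r 4 := hrmono (show (3 : Fin 5) < 4 by decide)
  have hpeel : 0 < D 0 * D 2 * D 5 - D 1 * D 3 * D 4 / 4 + D 0 * D 4 ^ 2 / 4 + D 2 * D 3 ^ 2 / 4 - D 5 * D 1 ^ 2 / 4 :=
    peel_gramDet_pos d₁ d₂ hd₁ hw (r 0) (r 1) (r 2) (r 3) (r 4) hr0 h01 h12 h23 h34 D hD'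
  have hQκ : κ 0 * κ 2 * κ 5 + κ 1 * κ 3 * κ 4 / 4 - κ 0 * κ 4 ^ 2 / 4 - κ 2 * κ 3 ^ 2 / 4 - κ 5 * κ 1 ^ 2 / 4
      = D 0 * D 2 * D 5 - D 1 * D 3 * D 4 / 4 + D 0 * D 4 ^ 2 / 4 + D 2 * D 3 ^ 2 / 4 - D 5 * D 1 ^ 2 / 4 := by
    simp only [hκ, show ((0 : Fin 6) : ℕ) = 0 from rfl, show ((1 : Fin 6) : ℕ) = 1 from rfl, show ((2 : Fin 6) : ℕ) = 2 from rfl,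
      show ((3 : Fin 6) : ℕ) = 3 from rfl, show ((4 : Fin 6) : ℕ) = 4 from rfl, show ((5 : Fin 6) : ℕ) = 5 from rfl]
    norm_num
    ring
  have hcube : (Matrix.of fun i j : Fin 3 => polar (S i) (S j)).det
      = lam ^ 3 * (D 0 * D 2 * D 5 - D 1 * D 3 * D 4 / 4 + D 0 * D 4 ^ 2 / 4 + D 2 * D 3 ^ 2 / 4 - D 5 * D 1 ^ 2 / 4) := by
    rw [hQq, ← hQκ, hqκ 0, hqκ 1, hqκ 2, hqκ 3, hqκ 4, hqκ 5]; ring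
  have hlam_nonneg : 0 ≤ lam := by
    have h3 : 0 ≤ lam ^ 3 := by
      by_contra hneg
      have : lam ^ 3 * (D 0 * D 2 * D 5 - D 1 * D 3 * D 4 / 4 + D 0 * D 4 ^ 2 / 4 + D 2 * D 3 ^ 2 / 4 - D 5 * D 1 ^ 2 / 4) < 0 :=
        mul_neg_of_neg_of_pos (lt_of_not_ge hneg) hpeel
      linarith [hgram_q, hcube]
    by_contra hneg
    have hl : lam < 0 := lt_of_not_ge hneg
    have hl2 : 0 < lam ^ 2 := by rw [pow_two]; exact mul_pos_of_neg_of_neg hl hl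
    have : lam ^ 3 < 0 := by rw [pow_succ]; exact mul_neg_of_pos_of_neg hl2 hl
    linarith
  have hlam_ne : lam ≠ 0 := by
    intro h0
    apply hfne
    rw [hfsum]
    refine Finset.sum_eq_zero fun j _ => ?_
    rw [hqκ j, h0, zero_mul, map_zero, zero_mul]
  have hlam_pos : 0 < lam := lt_of_le_of_ne hlam_nonneg (Ne.symm hlam_ne)
  -- the signs
  have hq0 : q 0 = (S 0).det := rfl
  have hq2 : q 2 = (S 1).det := rfl
  have hq5 : q (Fin.last 5) = (S 2).det := rfl
  have hκ0 : κ 0 = -D 0 := by rw [hκ]; simp only [show ((0 : Fin 6) : ℕ) = 0 from rfl]; norm_num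
  have hκ2 : κ 2 = -D 2 := by rw [hκ]; simp only [show ((2 : Fin 6) : ℕ) = 2 from rfl]; norm_num
  refine ⟨?_, ?_, ?_⟩
  · rw [← hq0, hqκ 0, hκ0, mul_neg_iff]; exact Or.inl ⟨hlam_pos, neg_neg_of_pos (hDpos 0)⟩
  · rw [← hq2, hqκ 2, hκ2, mul_neg_iff]; exact Or.inl ⟨hlam_pos, neg_neg_of_pos (hDpos 2)⟩
  · rw [← hq5, hqκ (Fin.last 5), hκ5]; exact mul_pos hlam_pos (hDpos _)

/-- The orientation law in the census' pencil notation `Σₗ X^{dₗ}·Sₗ` with `d = (0, d₁, d₂)`. [folklore] -/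
theorem orientation_law_pencil (d₁ d₂ : ℕ) (hd₁ : 0 < d₁) (hw : 2 * d₁ < d₂) (S : Fin 3 → Matrix (Fin 2) (Fin 2) ℝ) (hS : ∀ l, (S l).IsSymm)
    (h5 : 5 ≤ (((∑ l, (X : ℝ[X]) ^ (![0, d₁, d₂] : Fin 3 → ℕ) l • (S l).map C).det).roots.toFinset.filter (fun t => 0 < t)).card) :
    (S 0).det < 0 ∧ (S 1).det < 0 ∧ 0 < (S 2).det := by
  have hpen : (∑ l, (X : ℝ[X]) ^ (![0, d₁, d₂] : Fin 3 → ℕ) l • (S l).map C)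
      = (S 0).map C + (X : ℝ[X]) ^ d₁ • (S 1).map C + (X : ℝ[X]) ^ d₂ • (S 2).map C := by
    rw [Fin.sum_univ_three]
    simp only [Matrix.cons_val_zero, Matrix.cons_val_one, Matrix.head_cons, Matrix.cons_val_two, Matrix.tail_cons, pow_zero, one_smul]
  rw [hpen] at h5
  exact orientation_law d₁ d₂ hd₁ hw S hS h5

/-- **Definite beyond the roots** (census pencil notation, `d = (0, d₁, d₂)`).  Under the hypotheses of `orientation_law_pencil`, for every `x` exceeding all
real roots of the determinant, `det(Σₗ x^{dₗ} Sₗ) > 0` — the pencil is DEFINITE there (a real symmetric `2 × 2` matrix with positive determinant is definite). [folklore] -/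
theorem det_pencil_pos_beyond_roots (d₁ d₂ : ℕ) (hd₁ : 0 < d₁) (hw : 2 * d₁ < d₂) (S : Fin 3 → Matrix (Fin 2) (Fin 2) ℝ) (hS : ∀ l, (S l).IsSymm)
    (h5 : 5 ≤ (((∑ l, (X : ℝ[X]) ^ (![0, d₁, d₂] : Fin 3 → ℕ) l • (S l).map C).det).roots.toFinset.filter (fun t => 0 < t)).card)
    (x : ℝ) (hbeyond : ∀ t, ((∑ l, (X : ℝ[X]) ^ (![0, d₁, d₂] : Fin 3 → ℕ) l • (S l).map C).det).IsRoot t → t < x) :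
    0 < (∑ l, x ^ (![0, d₁, d₂] : Fin 3 → ℕ) l • S l).det := by
  classical
  obtain ⟨_, _, h2⟩ := orientation_law_pencil d₁ d₂ hd₁ hw S hS h5
  set f : ℝ[X] := (∑ l, (X : ℝ[X]) ^ (![0, d₁, d₂] : Fin 3 → ℕ) l • (S l).map C).det with hf
  have hpen : (∑ l, (X : ℝ[X]) ^ (![0, d₁, d₂] : Fin 3 → ℕ) l • (S l).map C)
      = (S 0).map C + (X : ℝ[X]) ^ d₁ • (S 1).map C + (X : ℝ[X]) ^ d₂ • (S 2).map C := by
    rw [Fin.sum_univ_three]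
    simp only [Matrix.cons_val_zero, Matrix.cons_val_one, Matrix.head_cons, Matrix.cons_val_two, Matrix.tail_cons, pow_zero, one_smul]
  set E : Fin 6 → ℕ := ![0, d₁, 2 * d₁, d₂, d₁ + d₂, 2 * d₂] with hE
  have hEmono : StrictMono E := by
    refine Fin.strictMono_iff_lt_succ.2 fun i => ?_
    fin_cases i <;> simp [hE] <;> omega
  set q : Fin 6 → ℝ := ![(S 0).det, 2 * polar (S 0) (S 1), (S 1).det, 2 * polar (S 0) (S 2), 2 * polar (S 1) (S 2), (S 2).det] with hq
  have hfsum : f = ∑ j : Fin 6, C (q j) * X ^ E j := by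
    rw [hf, hpen, det_pencil_three_letters_eq, Fin.sum_univ_six]; simp [hq, hE]
  have hdeg := natDegree_leadingCoeff_sum_C_mul_X_pow q E hEmono (show q (Fin.last 5) ≠ 0 from h2.ne')
  rw [← hfsum] at hdeg
  have hdegpos : 0 < f.degree := by
    rw [hdeg.1]; exact_mod_cast (show 0 < E (Fin.last 5) by simp [hE]; omega)
  have hlc : 0 < f.leadingCoeff := by rw [hdeg.2]; exact h2
  have hfne : f ≠ 0 := fun h0 => by rw [h0, leadingCoeff_zero] at hlc; exact lt_irrefl _ hlc
  -- a point a < x beyond all roots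
  obtain ⟨a, ha, hax⟩ : ∃ a, (∀ t, f.IsRoot t → t < a) ∧ a < x := by
    by_cases hne : f.roots.toFinset.Nonempty
    · have hmx : f.roots.toFinset.max' hne < x :=
        hbeyond _ ((mem_roots hfne).1 (Multiset.mem_toFinset.1 (Finset.max'_mem _ hne)))
      refine ⟨(f.roots.toFinset.max' hne + x) / 2, fun t ht => ?_, by linarith⟩
      have htm : t ≤ f.roots.toFinset.max' hne := Finset.le_max' _ _ (by rw [Multiset.mem_toFinset, mem_roots hfne]; exact ht)
      linarith
    · exact ⟨x - 1, fun t ht => absurd ⟨t, by rw [Multiset.mem_toFinset, mem_roots hfne]; exact ht⟩ hne, by linarith⟩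
  have hno : ∀ z, a < z → f.eval z ≠ 0 := fun z hz hfz => (lt_irrefl z) ((ha z hfz).trans hz)
  have hpos := leadingCoeff_mul_eval_pos_of_no_roots_beyond f hdegpos a hno x hax
  have hevalpos : 0 < f.eval x := pos_of_mul_pos_right hpos hlc.le
  rw [hf, eval_det_pencil] at hevalpos
  exact hevalpos

/-- **«LOSE TWO TO GAIN ONE», pointwise kernel form.**  If the determinant of a real symmetric three-letter `2 × 2` window pencil (`d = (0, d₁, d₂)`, `0 < d₁`,
`2d₁ < d₂`) has at least five positive roots, then beyond all its real roots NO DIAGONAL ENTRY of the evaluated pencil vanishes (the pencil is definite there).  On the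
`(3,4)` sheet: when the middle block `det(F|Π)` of a two-scale window anatomy has its five window roots, the top block `kᵀFk` (a diagonal entry of `F|Π`, `k ∈ Π`)
has no root beyond them. [folklore] -/
theorem diag_ne_zero_beyond_roots (d₁ d₂ : ℕ) (hd₁ : 0 < d₁) (hw : 2 * d₁ < d₂) (S : Fin 3 → Matrix (Fin 2) (Fin 2) ℝ) (hS : ∀ l, (S l).IsSymm)
    (h5 : 5 ≤ (((∑ l, (X : ℝ[X]) ^ (![0, d₁, d₂] : Fin 3 → ℕ) l • (S l).map C).det).roots.toFinset.filter (fun t => 0 < t)).card)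
    (x : ℝ) (hbeyond : ∀ t, ((∑ l, (X : ℝ[X]) ^ (![0, d₁, d₂] : Fin 3 → ℕ) l • (S l).map C).det).IsRoot t → t < x) (i : Fin 2) :
    (∑ l, x ^ (![0, d₁, d₂] : Fin 3 → ℕ) l • S l) i i ≠ 0 := by
  have hdet := det_pencil_pos_beyond_roots d₁ d₂ hd₁ hw S hS h5 x hbeyond
  set M : Matrix (Fin 2) (Fin 2) ℝ := ∑ l, x ^ (![0, d₁, d₂] : Fin 3 → ℕ) l • S l with hM
  have hMsymm : M 1 0 = M 0 1 := by
    have h : ∀ l, S l 1 0 = S l 0 1 := fun l => by simpa [Matrix.transpose_apply] using congrFun (congrFun (hS l) 0) 1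
    simp only [hM, Matrix.sum_apply, Matrix.smul_apply, smul_eq_mul, h]
  rw [Matrix.det_fin_two, hMsymm] at hdet
  intro h0
  fin_cases i
  · simp only [Fin.zero_eta, Fin.isValue] at h0
    rw [h0, zero_mul] at hdet; nlinarith [sq_nonneg (M 0 1)]
  · simp only [Fin.mk_one, Fin.isValue] at h0
    rw [h0, mul_zero] at hdet; nlinarith [sq_nonneg (M 0 1)]

end Summit.ValiantsHypothesis.ValiantsHypothesis.Theorems.LacunarySymmetroidMatrixDescartes.Census
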